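import Summits.Ventures.MM22.Rank333.Wang333LPCert
import HarnessLib

/-!
# MM22 venture — `⟨3,3,3⟩/𝔽₂`: assembly lemmas for kernel replays of per-orbit LIFT certificates over Wang's table

HONEST FRAMING (cell `pub-mm22`, seat p3 g4; v4 item (0′)/(C) "kernel upgrade"). Generic glue, PROVED (0 sorry); no bound is
claimed here. The cell's cascade of per-orbit lifts of Wang's printed `⟨3,3,3⟩/𝔽₂` table (arXiv:2603.07280; e.g. orbit 478:
17 → 18, orbits 479/484/…: 18 → 19; certificates = p1's / p2's integer substitution-LP DFS trees, `certificates/cascade/`) is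
replayed in the kernel one orbit at a time as a SHORT hypotheses-sweep (`Wang333LPAssembly.sweepXH`): the orbit list `os` of a
lift consists of step-less HYPOTHESIS entries — the cited orbits at their currently certified values — followed by the lifted
orbit with its steps (a plain lookup of itself for the running bound, then one LP-DFS round, or a single LP leaf), checked through
the fast path (`GF2FastLB/Table/Leaf.lean`). The hypotheses are discharged from KERNEL facts only: Wang's printed values, all of
which are theorems of the landed chain (`certX` below, from `Wang333LPCert.lean`), and lift theorems landed earlier
(`Lift333O*.lean`). This file: `certX`; the Boolean cross-check `hh_of_osX` of hypothesis entries against `osX`;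
list glue `hh_nil` / `hh_cons` / `hh_append`; `stepSideX_look` (side conditions of a plain lookup from the FAST pull-back check);
`rootsOKX_look`; `rootsOKX_lp_of_fastL` (a single LP leaf through the value-tree oracle and the list-path leaf test);
`obligs_all`; and the one-call assembly `lift_of_parts`.
-/

namespace Summit.Ventures.MM22.GF2Cert.Lift333

open Summit.MatrixMultiplication.OmegaCensus.GF2RankLB Literature.Computability.AlgebraicComplexity
open Summit.Ventures.MM22.GF2Cert Summit.Ventures.MM22.GF2Cert.LP333

/-- **Every orbit of the landed chain `osX` is certified at Wang's printed value** (kernel theorem of `Wang333LPCert.lean`,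
read off by index). -/
theorem certX (i : ℕ) (hi : i < 494) : Cert 3 3 3 (kOf (coreOf osX) i) (bnd (coreOf osX) i) :=
  sweepX (l := 3) (n := 3) osX (fun i hi => okall i (by rw [osX_length] at hi; exact hi))
    (fun i hi => oball i (by rw [osX_length] at hi; exact hi)) i (by rw [osX_length]; exact hi)

/-- **Hypotheses sourced from Wang's printed table hold** (via `certX`), given the Boolean cross-check of each hypothesis entry
`e = (p, b)` of the lift's orbit list `os` against the landed chain: some source row `(p, j)` of `src` has `j < 494`, entry `p`
of `os` carries literally the constraint list of orbit `j` of `osX`, and `b` is at most Wang's value there. -/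
theorem hh_of_osX (os : List OrbitX) (hyps src : List (ℕ × ℕ))
    (h : (hyps.all fun e => src.any fun s => (s.1 == e.1) && Nat.blt s.2 494 &&
      (kOf (coreOf os) e.1 == kOf (coreOf osX) s.2) && Nat.ble e.2 (bnd (coreOf osX) s.2)) = true) :
    ∀ e ∈ hyps, Cert 3 3 3 (kOf (coreOf os) e.1) e.2 := by
  intro e he
  rw [List.all_eq_true] at h
  have h1 := h e he
  rw [List.any_eq_true] at h1
  obtain ⟨s, _, hs⟩ := h1
  simp only [Bool.and_eq_true, beq_iff_eq, Nat.blt_eq, Nat.ble_eq] at hs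
  obtain ⟨⟨⟨_, hj⟩, hK⟩, hb⟩ := hs
  rw [hK]
  exact cert_mono hb (certX s.2 hj)

/-- No hypotheses: vacuous. -/
theorem hh_nil (os : List OrbitX) : ∀ e ∈ ([] : List (ℕ × ℕ)), Cert 3 3 3 (kOf (coreOf os) e.1) e.2 :=
  fun _ he => absurd he List.not_mem_nil

/-- One more hypothesis, discharged by a named fact. -/
theorem hh_cons (os : List OrbitX) (p b : ℕ) (rest : List (ℕ × ℕ)) (h1 : Cert 3 3 3 (kOf (coreOf os) p) b)
    (h2 : ∀ e ∈ rest, Cert 3 3 3 (kOf (coreOf os) e.1) e.2) :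
    ∀ e ∈ ((p, b) :: rest), Cert 3 3 3 (kOf (coreOf os) e.1) e.2 := by
  intro e he
  rcases List.mem_cons.1 he with rfl | he
  exacts [h1, h2 e he]

/-- Hypotheses of a concatenation. -/
theorem hh_append (os : List OrbitX) {A B : List (ℕ × ℕ)} (hA : ∀ e ∈ A, Cert 3 3 3 (kOf (coreOf os) e.1) e.2)
    (hB : ∀ e ∈ B, Cert 3 3 3 (kOf (coreOf os) e.1) e.2) : ∀ e ∈ A ++ B, Cert 3 3 3 (kOf (coreOf os) e.1) e.2 := by
  intro e he
  rcases List.mem_append.1 he with h | h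
  exacts [hA e h, hB e h]

/-- Side conditions of a plain lookup step from the FAST pull-back check (`sandFB`, `GF2FastSandwich.lean`). -/
theorem stepSideX_look (os : List OrbitX) (i : ℕ) (K : List ℕ) (cur : ℕ) {extra : List ℕ} {j P Pi Q Qi : ℕ}
    (hj : j < i) (h : sandFB 3 3 (kOf (coreOf os) j) (K ++ extra) P Pi Q Qi = true) :
    stepSideX 3 3 os i K cur (.old (.look extra j P Pi Q Qi)) = true := by
  simp only [stepSideX, stepSide, hj, decide_true, Bool.true_and]
  exact sandB_of_sandFB h

/-- A lookup step has no separately checked pieces. -/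
theorem rootsOKX_look (os : List OrbitX) (extra : List ℕ) (j P Pi Q Qi : ℕ) :
    RootsOKX os (.old (.look extra j P Pi Q Qi)) := trivial

/-- **A single LP leaf at the root passes** (`RootsOKX` of an `lp` step) from: key-sorted tables, a value tree whose nodes pass
`hintOK`, and the list-path leaf test `lpLeafL` with the value tree as oracle (monotonicity `lpLeafMB_mono`). -/
theorem rootsOKX_lp_of_fastL (os : List OrbitX) {cands : List ℕ} {target : ℕ} {tb tt : List LookRow}
    {rows : List (ℕ × ℕ)} {D : ℕ} (vt : VTree) (hb : keysAscB tb = true) (ht : keysAscB tt = true)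
    (hvt : vt.allB (hintOK (coreOf os) tb tt cands.length) = true)
    (h : lpLeafL cands.length vt.find target rows D 0 [] = true) : RootsOKX os (.lp cands target tb tt rows D) := by
  have hle : ∀ fm, vt.find fm ≤ lbOf2 (coreOf os) tb tt (setOf cands.length fm) :=
    VTree.find_le (fun _ _ _ hk => le_lbOf2_of_hintOK (coreOf os) hb ht hk) vt hvt
  have h1 : lpLeafMB vt.find target rows D 0 (Fin.elim0 : Fin 0 → Fin cands.length) = true :=
    lpLeafMB_of_lpLeafL (by rw [List.ofFn_zero]; exact h)
  exact lpLeafMB_mono hle h1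

/-- Residual obligations of the first `n` orbits, none of which has a forced-product step. -/
theorem obligs_all (os : List OrbitX) (n : ℕ) (h : allRange (fun i => noForcedBX (os.getD i default).steps) 0 n = true) :
    ∀ i < n, ObligsX 3 3 os i :=
  fun i hi => obligsX_of_noForced os i (forall_lt_of_allRange_zero h i hi)

/-- **One-call assembly of a lift**: the orbit list `os` has `m` hypothesis entries (each passing `okXH` by its hypothesis)
followed by the lifted orbit at position `m` (passing its own extended check `hok`); no forced products anywhere; all
hypotheses certified (`hh`); then the entry at `m` is certified, read off with literal `K` and any `b ≤` its bound. -/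
theorem lift_of_parts (os : List OrbitX) (hyps : List (ℕ × ℕ)) (m : ℕ) (hlen : os.length = m + 1)
    (hhyp : allRange (fun i => okXH 3 3 os hyps i) 0 m = true) (hok : orbitCheckX 3 3 os m = true)
    (hob : allRange (fun i => noForcedBX (os.getD i default).steps) 0 (m + 1) = true)
    (hh : ∀ e ∈ hyps, Cert 3 3 3 (kOf (coreOf os) e.1) e.2) {K : List ℕ} {b : ℕ}
    (hK : kOf (coreOf os) m = K) (hb : b ≤ bnd (coreOf os) m) : Cert 3 3 3 K b :=
  cert_of_sweepXH os hyps
    (fun i hi => forall_lt_succ' (fun i => okXH 3 3 os hyps i = true) m (m + 1) rfl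
      (forall_lt_of_allRange_zero hhyp) (okXH_of_orbitCheckX hok) i (hlen ▸ hi))
    (fun i hi => obligs_all os (m + 1) hob i (hlen ▸ hi)) hh m (by omega) hK hb

end Summit.Ventures.MM22.GF2Cert.Lift333
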